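import Literature.NumberTheory.GaloisCohomology.KatoCohomologyPurityDeRham
import Literature.NumberTheory.GaloisCohomology.BlochKatoFormsEquiv
import Mathlib.RingTheory.Ideal.Height
import Mathlib.Algebra.Order.SuccPred
import HarnessLib

/-!
# Gersten purity for Kato's `H^{n+1}_p` on differential forms: the cases of height `≤ 1`

Companion to `GaloisCohomology/KatoCohomologyPurityDeRham`, which records the NAMED FACT
`GrosSuwa1988_purity_deRham` ([cite: GrosSuwa1988, Thm. 1.4], Gersten's conjecture for the logarithmic
Hodge–Witt sheaves on localizations of smooth schemes over a perfect field, in the affine-model form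
consumed by route WildPurity of summit ResolutionOfSingularities): for an affine model `B ⊆ K` over a
perfect field `k` (`B` finitely generated, `Frac B = K`) and a prime `𝔮` of `B` with `B_𝔮` regular, a
class of `KatoCohomologyDeRham p K n` that is generated by `(B_𝔮)_P`-integral logarithmic form classes
for EVERY height-one prime `P` of `B_𝔮 = localizationIn K 𝔮` is generated by `B_𝔮`-integral ones.

This file PROVES the fact in the two elementary cases `height 𝔮 ≤ 1` (unconditionally, with the same
binders as the fact plus `𝔮.height ≤ 1`):

* `height 𝔮 = 1`: `T := B_𝔮 ⊆ K` is a local ring (`IsLocalization.AtPrime T 𝔮`) whose maximal ideal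
  `M` has height `1` (`IsLocalization.height_under`, `IsLocalization.AtPrime.under_maximalIdeal`), so the
  hypothesis applies to `P := M`; and localising a local ring at its maximal ideal adds nothing:
  `T_M = T` inside `K` (`localizationIn_maximalIdeal_eq_range`,
  `localizationIn_maximalIdeal_subset`), whence the conclusion by monotonicity of
  `integralFormClasses` in the coefficient set (`integralFormClasses_mono`).
* `height 𝔮 = 0`: `𝔮 = ⊥` (`Ideal.height_eq_zero_iff_eq_bot`), `B_⊥ = K` (`localizationIn_bot_eq_univ`),
  and the form classes `formClass p a b` (`a ∈ K`, `b : Fin n → Kˣ`) generate ALL of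
  `KatoCohomologyDeRham p K n` (`integralFormClasses_univ`): the quotient map from `Ωⁿ_K` is surjective
  and the logarithmic forms span `Ωⁿ_K` over the field `K` (`BlochKatoForms.span_range_tupleForm`,
  the surjectivity half of [cite: BlochKato1986, Lemma (4.2)], from `exteriorPower.ιMulti_span_of_span`,
  `KaehlerDifferential.span_range_derivation` and `BlochKatoForms.ιMulti_D_eq_prod_smul_tupleForm`).

Main statement: `grosSuwa1988_purity_deRham_of_height_le_one`.  The general case (height `≥ 2`) is the
genuine content of Gros–Suwa's theorem (inverse Cartier operator, Cousin complex) and is NOT here.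

## References

* M. Gros, N. Suwa, *La conjecture de Gersten pour les faisceaux de Hodge–Witt logarithmique*, Duke
  Math. J. 57 (1988), 615–628, Thm. 1.4. [GrosSuwa1988]
* S. Bloch, K. Kato, *p-adic étale cohomology*, Publ. Math. IHÉS 63 (1986), Lemma (4.2). [BlochKato1986]
-/

noncomputable section

open KaehlerDifferential (D)

namespace Literature.NumberTheory.GaloisCohomology

universe u v w

/-! ## Localising at `⊥` and at the maximal ideal of a local ring -/

section LocalizationIn

/-- **`A_⊥ = K`**: the localisation of a domain `A` at the zero ideal, realised inside its fraction
field `K`, is all of `K` (every `x ∈ K` is `a / s` with `a, s ∈ A`, `s ≠ 0`). [folklore] -/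
theorem localizationIn_bot_eq_univ (A : Type v) [CommRing A] [IsDomain A] (K : Type w) [Field K]
    [Algebra A K] [IsFractionRing A K] :
    (localizationIn K (⊥ : Ideal A) : Set K) = Set.univ := by
  refine Set.eq_univ_of_forall fun x => ?_
  obtain ⟨a, s, hs, rfl⟩ := IsFractionRing.div_surjective (A := A) x
  have hs0 : algebraMap A K s ≠ 0 := IsFractionRing.to_map_ne_zero_of_mem_nonZeroDivisors hs
  refine (mem_localizationIn_iff (⊥ : Ideal A) _).2 ⟨a, s, ?_, ?_⟩
  · rw [Ideal.mem_bot]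
    exact nonZeroDivisors.ne_zero hs
  · rw [div_mul_cancel₀ _ hs0]

/-- **`A_𝔪 = A` for a local domain `A`**: localising a local domain at its maximal ideal adds nothing —
inside the fraction field `K`, `localizationIn K 𝔪` is the image of `A` (an element `a / s` with
`s ∉ 𝔪`, i.e. `s` a unit, equals `a s⁻¹ ∈ A`). [folklore] -/
theorem localizationIn_maximalIdeal_eq_range (A : Type v) [CommRing A] [IsDomain A] [IsLocalRing A]
    (K : Type w) [Field K] [Algebra A K] [IsFractionRing A K] :
    (localizationIn K (IsLocalRing.maximalIdeal A) : Set K) = Set.range (algebraMap A K) := by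
  refine Set.Subset.antisymm (fun x hx => ?_) (range_subset_localizationIn _)
  obtain ⟨a, s, hs, h⟩ := (mem_localizationIn_iff (IsLocalRing.maximalIdeal A) x).1 hx
  obtain ⟨u, rfl⟩ := IsLocalRing.notMem_maximalIdeal.1 hs
  refine ⟨a * ↑u⁻¹, ?_⟩
  rw [map_mul, ← h, mul_assoc, ← map_mul, Units.mul_inv, map_one, mul_one]

/-- **`(A_𝔮)_𝔪 ⊆ A_𝔮` inside `K`**: for a domain `A` with fraction field `K`, a prime `𝔮` of `A` and
the local ring `T := A_𝔮 ⊆ K` (`localizationIn K 𝔮`, local as `IsLocalization.AtPrime T 𝔮`), the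
localisation of `T` at its maximal ideal, realised inside `K`, is contained in (indeed equal to) `T`.
The `IsLocalRing` instance is taken as a hypothesis (it always holds:
`IsLocalization.AtPrime.isLocalRing T 𝔮`). [folklore] -/
theorem localizationIn_maximalIdeal_subset {A : Type v} [CommRing A] [IsDomain A] (K : Type w) [Field K]
    [Algebra A K] [IsFractionRing A K] (𝔮 : Ideal A) [𝔮.IsPrime]
    [IsLocalRing (localizationIn K 𝔮)] :
    (localizationIn K (IsLocalRing.maximalIdeal (localizationIn K 𝔮)) : Set K) ⊆
      (localizationIn K 𝔮 : Set K) := by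
  rw [localizationIn_maximalIdeal_eq_range]
  rintro _ ⟨t, rfl⟩
  exact t.2

end LocalizationIn

/-! ## Monotonicity of `integralFormClasses`, and the case `T = K` -/

section IntegralFormClasses

/-- `integralFormClasses p n T` is monotone in the coefficient set `T`. [folklore] -/
theorem integralFormClasses_mono (p n : ℕ) {K : Type w} [CommRing K] {T T' : Set K} (h : T ⊆ T') :
    integralFormClasses p n T ≤ integralFormClasses p n T' := by
  refine AddSubgroup.closure_mono ?_
  rintro _ ⟨a, b, ha, hb, rfl⟩
  exact ⟨a, b, h ha, fun i => ⟨h (hb i).1, h (hb i).2⟩, rfl⟩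

namespace BlochKatoForms

/-- **Bloch–Kato, Lemma (4.2), surjectivity of `δ`, for a field**: the logarithmic forms of tuples
`tupleForm K v` (`= dlog v₀ ∧ ⋯ ∧ dlog v_{n-1}` if all `vᵢ ≠ 0`, else `0`) span `Ωⁿ_K = ⋀ⁿ_K Ω[K⁄ℤ]`
over `K`: `Ω[K⁄ℤ]` is spanned by the `da`, hence `Ωⁿ_K` by the `da₀ ∧ ⋯ ∧ da_{n-1} = (∏ aᵢ) • tupleForm a`.
[cite: BlochKato1986, Lemma (4.2)] -/
theorem span_range_tupleForm (K : Type u) [Field K] (n : ℕ) :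
    Submodule.span K (Set.range (tupleForm K (n := n))) = ⊤ := by
  rw [eq_top_iff, ← exteriorPower.ιMulti_span_of_span K n (Ω[K⁄ℤ])
    (KaehlerDifferential.span_range_derivation (R := ℤ) (S := K)), Submodule.span_le]
  rintro _ ⟨x, hxs, rfl⟩
  -- each `x i ∈ Set.range (D ℤ K)` is `D (a i)`
  choose a ha using fun i => hxs (Set.mem_range_self i)
  have hx : x = fun i => D ℤ K (a i) := funext fun i => (ha i).symm
  rw [SetLike.mem_coe, hx, ιMulti_D_eq_prod_smul_tupleForm]
  exact Submodule.smul_mem _ _ (Submodule.subset_span (Set.mem_range_self _))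

/-- The class of `c • tupleForm K v` in `KatoCohomologyDeRham p K n` is a form class `formClass p a b`
(with `a = c`, `bᵢ = vᵢ` if all `vᵢ ≠ 0`, and the zero class `formClass p 0 1` otherwise). [folklore] -/
theorem exists_mk_smul_tupleForm_eq_formClass (p : ℕ) (K : Type u) [Field K] {n : ℕ} (c : K)
    (v : Fin n → K) :
    ∃ (a : K) (b : Fin n → Kˣ),
      ((c • tupleForm K v : ⋀[K]^n (Ω[K⁄ℤ])) : KatoCohomologyDeRham p K n) = formClass p a b := by
  by_cases h : ∀ i, v i ≠ 0
  · refine ⟨c, fun i => Units.mk0 (v i) (h i), ?_⟩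
    rw [tupleForm, dif_pos h]
    rfl
  · refine ⟨0, 1, ?_⟩
    rw [tupleForm, dif_neg h, smul_zero, formClass, zero_smul]

end BlochKatoForms

/-- **For a field `K`, the form classes generate Kato's group**: `integralFormClasses p n K = ⊤`, i.e.
every class of `KatoCohomologyDeRham p K n = Ωⁿ_K/(dΩⁿ⁻¹_K + ⟨(a^p − a) dlog b⟩)` is a sum of classes
`formClass p a b` (`a ∈ K`, `b : Fin n → Kˣ`): the quotient map from `Ωⁿ_K` is surjective and the
logarithmic forms span `Ωⁿ_K` over `K` (`BlochKatoForms.span_range_tupleForm`), a `K`-multiple of a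
logarithmic form being again of the shape `a • dlog b₀ ∧ ⋯`. [cite: BlochKato1986, Lemma (4.2)] -/
theorem integralFormClasses_univ (p : ℕ) (K : Type u) [Field K] (n : ℕ) :
    integralFormClasses p n (Set.univ : Set K) = ⊤ := by
  rw [eq_top_iff]
  rintro α -
  obtain ⟨ω, rfl⟩ := QuotientAddGroup.mk_surjective α
  have hω : ω ∈ Submodule.span K (Set.range (BlochKatoForms.tupleForm K (n := n))) := by
    rw [BlochKatoForms.span_range_tupleForm]; trivial
  suffices H : ∀ c : K,
      ((c • ω : ⋀[K]^n (Ω[K⁄ℤ])) : KatoCohomologyDeRham p K n) ∈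
        integralFormClasses p n (Set.univ : Set K) by
    simpa only [one_smul] using H 1
  induction hω using Submodule.span_induction with
  | mem x hx =>
    obtain ⟨v, rfl⟩ := hx
    intro c
    obtain ⟨a, b, hab⟩ := BlochKatoForms.exists_mk_smul_tupleForm_eq_formClass p K c v
    exact AddSubgroup.subset_closure
      ⟨a, b, Set.mem_univ _, fun _ => ⟨Set.mem_univ _, Set.mem_univ _⟩, hab⟩
  | zero =>
    intro c
    rw [smul_zero, QuotientAddGroup.mk_zero]
    exact zero_mem _
  | add x y _ _ hx hy =>
    intro c
    rw [smul_add, QuotientAddGroup.mk_add]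
    exact add_mem (hx c) (hy c)
  | smul r x _ hx =>
    intro c
    rw [smul_smul]
    exact hx (c * r)

end IntegralFormClasses

/-! ## The named fact in height `≤ 1` -/

/-- **Gersten purity for Kato's `H^{n+1}_p` on differential forms, at a point of height `≤ 1`** — the
cases `height 𝔮 ≤ 1` of the named fact `GrosSuwa1988_purity_deRham` ([cite: GrosSuwa1988, Thm. 1.4],
Gersten's conjecture for the logarithmic Hodge–Witt sheaves on localizations of smooth schemes over a
perfect field, affine-model form), PROVED unconditionally and with the same binders plus `𝔮.height ≤ 1`:
for `k` perfect of characteristic `p`, `K` a field, `B ⊆ K` a finitely generated `k`-subalgebra with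
`Frac B = K`, `𝔮` a prime of `B` of height `≤ 1` with `B_𝔮` regular, every class of
`KatoCohomologyDeRham p K n` that is generated by `(B_𝔮)_P`-integral logarithmic form classes for every
height-one prime `P` of `B_𝔮 = localizationIn K 𝔮` is generated by `B_𝔮`-integral ones.  Height `1`:
`B_𝔮 ⊆ K` is local with maximal ideal `M` of height `1`, the hypothesis at `P := M` and
`(B_𝔮)_M ⊆ B_𝔮` (`localizationIn_maximalIdeal_subset`, `integralFormClasses_mono`).  Height `0`:
`𝔮 = ⊥`, `B_⊥ = K` (`localizationIn_bot_eq_univ`) and the form classes generate everything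
(`integralFormClasses_univ`).  (Regularity, perfectness and finite generation are not used.)
[cite: GrosSuwa1988, Thm. 1.4] -/
theorem grosSuwa1988_purity_deRham_of_height_le_one :
    ∀ (p : ℕ), p.Prime → ∀ (k K : Type u) [Field k] [CharP k p] [PerfectField k] [Field K] [Algebra k K]
    (B : Subalgebra k K) [IsFractionRing B K], B.FG → ∀ (𝔮 : Ideal B) [𝔮.IsPrime],
    IsRegularLocalRing (Localization.AtPrime 𝔮) → 𝔮.height ≤ 1 →
      ∀ (n : ℕ) (α : KatoCohomologyDeRham p K n),
      (∀ (P : Ideal (localizationIn K 𝔮)) [P.IsPrime], P.height = 1 →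
        α ∈ AddSubgroup.closure {x : KatoCohomologyDeRham p K n | ∃ (a : K) (b : Fin n → Kˣ),
          a ∈ (localizationIn K P : Set K) ∧
          (∀ i, (b i : K) ∈ (localizationIn K P : Set K) ∧
            (((b i)⁻¹ : Kˣ) : K) ∈ (localizationIn K P : Set K)) ∧
          x = formClass p a b}) →
      α ∈ AddSubgroup.closure {x : KatoCohomologyDeRham p K n | ∃ (a : K) (b : Fin n → Kˣ),
          a ∈ (localizationIn K 𝔮 : Set K) ∧
          (∀ i, (b i : K) ∈ (localizationIn K 𝔮 : Set K) ∧
            (((b i)⁻¹ : Kˣ) : K) ∈ (localizationIn K 𝔮 : Set K)) ∧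
          x = formClass p a b} := by
  intro p _hp k K _ _ _ _ _ B _ _hB 𝔮 _ _hreg h𝔮 n α hα
  -- the goal and the hypothesis are literally about `integralFormClasses`
  change α ∈ integralFormClasses p n (localizationIn K 𝔮 : Set K)
  rcases h𝔮.lt_or_eq with h0 | h1
  · -- height `0`: `𝔮 = ⊥`, `B_⊥ = K`, and the form classes generate everything
    have hbot : 𝔮 = ⊥ := Ideal.height_eq_zero_iff_eq_bot.1 (Order.lt_one_iff.1 h0)
    subst hbot
    rw [localizationIn_bot_eq_univ, integralFormClasses_univ]
    trivial
  · -- height `1`: `T := B_𝔮 ⊆ K` is local with maximal ideal `M` of height `1`, and `T_M ⊆ T`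
    haveI : IsLocalization.AtPrime (localizationIn K 𝔮) 𝔮 :=
      Localization.subalgebra.isLocalization_ofField K 𝔮.primeCompl 𝔮.primeCompl_le_nonZeroDivisors
    haveI : IsLocalRing (localizationIn K 𝔮) :=
      IsLocalization.AtPrime.isLocalRing (localizationIn K 𝔮) 𝔮
    have hM : (IsLocalRing.maximalIdeal (localizationIn K 𝔮)).height = 1 := by
      rw [← IsLocalization.height_under 𝔮.primeCompl (IsLocalRing.maximalIdeal (localizationIn K 𝔮)),
        IsLocalization.AtPrime.under_maximalIdeal (localizationIn K 𝔮) 𝔮]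
      exact h1
    exact integralFormClasses_mono p n (localizationIn_maximalIdeal_subset K 𝔮)
      (hα (IsLocalRing.maximalIdeal (localizationIn K 𝔮)) hM)

end Literature.NumberTheory.GaloisCohomology

end
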